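import Summits.QuantumFields.YangMills.Theorems.BalabanUVNodesN15BackgroundSiteWords
import Summits.QuantumFields.YangMills.Theorems.BalabanUVNodesN15BackgroundLayerEntriesOfLetters
import HarnessLib

/-!
# Route «BalabanUVNodes» (K4 «SpineRates»), node N15 = NE2 — THE SITE-KERNEL LAYER WITH THE BACKGROUND LIVE, III: THE DRESSED SITE KERNEL FROM THE THREE
# PERTURBATION LETTERS — `G′(U′U) = pr_none (1 − ĜV̂)⁻¹Ĝ` (n15-b B1∕B1a's pair-space object) with its majorant, its smallness `G′(U′U) − G′ = G′V̂X̂` and its η-defect,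
# fed to S2's (3.65) words and S1's exact inverse rule: `𝔇(D′, D) ≤ siteAmp·θ·e^{−(δ−5σ)d}` for ANY perturbation `V̂` with the three letters and ANY averaging
# species with block-local letters — the species-independent half of every background-live site layer of this lineage

Cell `pub-ymgap`, seat `pub-ymgap-dag-n15-c` (generation g5; R134 ACCELERATION SEAT, strategy s1; HUMAN RULING D-0062; chair R424 venue; `bears_on: R4∕N15`).  Filed
`--supports stmt-QuantumFields-20292 --as helper` (K3⁗; count-neutral).  Imports this seat's S2 `…N15BackgroundSiteWords` (S1 through it) and g2's V0
`…N15BackgroundLayerEntriesOfLetters` (`idef_projO_comp`; through it n15-b B1∕B1a∕A1–A3: `stack`, `projO`, `blkPair`, `liftPair`, `hasMaj_stack`, `hasMaj_projO_comp`,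
`idef_stack`, `bgPropV`, `bgPropV_fix`, `isUnit_stepV`, `hasMaj_bgPropV`, `hasMaj_V_bgPropV`, `hasMaj_idef_bgPropV`, `bgConst`, `poly0_le`, `B9SectDSup.inv_one_sub_le_two`)
BY NAME; nothing in the tree is modified.

WHAT THIS FILE IS (the species-independent half, as V0 is for the operator layer).  Every background-live operator layer of n15-b∕-c (B4, C2, M3∕M4, G2∕G3, V2∕W4∕B1,
F2∕F3∕F16 …) is the pair `X̂ = bgPropV (stack G D) V̂` of (3.64)–(3.65) for SOME first-order perturbation `V̂` of the stacked `U ≡ 1` layer carrying THREE LETTERS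
(`V̂, V̂′ ≤ diagK R`, `𝔇(V̂′, V̂) ≤ diagK (Rθ)`), read on the `none` component: the dressed propagator `G′(U′U) = dressedOp G D V̂ := pr_none ∘ X̂`.  §1 proves its three
letters: the majorant `B·e^{−(δ−σ)d}`, `B = β(1 − βRc_r)⁻¹` (`hasMaj_dressedOp`); the SMALLNESS `G′(U′U) − G′ = G∘(V̂∘X̂) ≤ β(RB)c_r·e^{−(δ−σ)d}` (`dressedOp_sub_eq` = the
print's (3.65) «G′(U′U) = G′(U) + G′(U)V′(A)G′(U′U)» read on the pair space, `hasMaj_dressedOp_sub`); the η-defect `𝔇 ≤ bgConst·θ·e^{−(δ−σ)d}` under V0's guard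
(`hasMaj_idef_dressedOp` — V0's entry 0 without the source ∕ derived pieces).  §2 feeds them, together with ANY averaging species `F₂, F₂*` with block-local
letters (`≤ diagK r`, fits `≤ diagK (o₀θ)`) and the `U ≡ 1` site kernels `W, W′` (majorant `β_W·e^{−δd}`, `K₀W = 1 = K₀′W′` for `K₀ = QG²Q*` — BINDERS, the printed
Thm 3.2 (3.48) object at `U ≡ 1`), to S2's `hasMaj_siteC` ∕ `hasMaj_idef_siteForm` and S1's `hasMaj_idef_siteInv`: ★ **`hasMaj_idef_dressedSite`** — the η-defect of the
DRESSED SITE KERNELS `[Q′(U′U)G′²(U′U)Q′*(U′U)]⁻¹` of the two spacings is `≤ siteAmp·θ·e^{−(δ−5σ)d}`, ONE rate factor `θ`, constants explicit (`xAmp`, `cAmp`, `siteAmp`).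

HONEST FRAMING ∕ LIMITS.  MECHANISM + linear algebra over hypothesis-shaped data: the `U ≡ 1` layer, the perturbation letters, the species letters and the `U ≡ 1`
site kernels are BINDERS (the sequel discharges the perturbation ∕ species letters from (3.35) on a gauge carrier and reads the result as `NE2PlusSite` BY NAME;
`W` stays displayed).  Nothing about Bałaban's `G(U)`, `Q(U)` is asserted; `U ≡ 1` is the background around which `U′` perturbs.  NE2⁺ NOT PRINTED, NOT proved;
count-neutral (typed 28∕28; discharged count unchanged); N15 NOT discharged; one finite T⁴ at fixed ε — NOT infinite volume, NOT OS on ℝ⁴, NOT a mass gap, NOT Clay.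
-/

noncomputable section

namespace Summit.QuantumFields.YangMills.BalabanUVNodes.N15.SiteLayer

open Literature.MathematicalPhysics.QuantumFieldTheory.Balaban1983to89
open Literature.MathematicalPhysics.QuantumFieldTheory.Balaban1983to89.B11SectG (BlockNorm HasMaj hasMaj_comp hasMaj_comp_exp RowSum)
open Literature.MathematicalPhysics.QuantumFieldTheory.Balaban1983to89.T4EtaRateDefect (idef)
open Literature.MathematicalPhysics.QuantumFieldTheory.Balaban1983to89.T4EtaRateCoeffDefect (pull diagK fibre)
open Literature.MathematicalPhysics.QuantumFieldTheory.Balaban1983to89.B6RandomWalk (Triangle254)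
open Literature.MathematicalPhysics.QuantumFieldTheory.Balaban1983to89.B9SectDSup (inv_one_sub_le_two)
open Summit.QuantumFields.YangMills.BalabanUVNodes.N15.BackgroundModel (kappa_ofBlocks)
open Summit.QuantumFields.YangMills.BalabanUVNodes.N15.BackgroundLayer (fibAvg projO stack blkPair liftPair hasMaj_stack hasMaj_projO_comp idef_stack
  idef_projO_comp bgPropV bgPropV_fix isUnit_stepV hasMaj_bgPropV hasMaj_V_bgPropV hasMaj_idef_bgPropV bgConst bgConst_nonneg poly0_le)

/-! ## §1 The dressed propagator on the pair space and its three letters -/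

section Dressed

variable {X X' J : Type} [Fintype X] [Fintype X'] [Fintype J] [DecidableEq X] [DecidableEq X'] [DecidableEq J] {g : B6.Geometry}
  (blk : X → g.Site) (π : X' → X) {σ cr : ℝ}

/-- THE DRESSED PROPAGATOR `G′(U′U) = pr_none (1 − ĜV̂)⁻¹Ĝ` — the `none` component of n15-b's pair-space object `bgPropV (stack G D) V̂` (the derived pieces `D_μ`
stacked under `G` so that the first-order `V̂` acts with a diagonal majorant). [cite: Balaban1985BackgroundPropagators, (3.64) p.403 (shape)] -/
def dressedOp (G : (X → ℝ) →ₗ[ℝ] (X → ℝ)) (D : J → (X → ℝ) →ₗ[ℝ] (X → ℝ)) (V : (X × Option J → ℝ) →ₗ[ℝ] (X → ℝ)) : (X → ℝ) →ₗ[ℝ] (X → ℝ) :=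
  projO none ∘ₗ bgPropV (stack G D) V

variable {G : (X → ℝ) →ₗ[ℝ] (X → ℝ)} {D : J → (X → ℝ) →ₗ[ℝ] (X → ℝ)} {G' : (X' → ℝ) →ₗ[ℝ] (X' → ℝ)} {D' : J → (X' → ℝ) →ₗ[ℝ] (X' → ℝ)}
  {V : (X × Option J → ℝ) →ₗ[ℝ] (X → ℝ)} {V' : (X' × Option J → ℝ) →ₗ[ℝ] (X' → ℝ)} {δ β R : ℝ}

omit [Fintype X'] [DecidableEq X'] in
/-- **LETTER 1 — THE MAJORANT** `G′(U′U) ≤ β(1 − βRc_r)⁻¹·e^{−ρd}` (`ρ + σ ≤ δ`) from `G, D_μ ≤ β·e^{−δd}`, `V̂ ≤ diagK R`, `βRc_r < 1`. [cite: Balaban1985BackgroundPropagators, (3.64) p.403 (mechanism); Thm 3.4 p.400 («The extended operators satisfy all the inequalities of Theorems 3.1–3.3»: shape)] -/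
theorem hasMaj_dressedOp (htri : Triangle254 g) (hd : ∀ a b : g.Site, 0 ≤ g.dist a b) (hrow : RowSum g σ cr) (hσ : 0 ≤ σ) {ρ : ℝ} (hρ : 0 ≤ ρ)
    (hρδ : ρ + σ ≤ δ) (hβ : 0 ≤ β) (hR : 0 ≤ R)
    (hG : HasMaj (BlockNorm.ofBlocks g blk) (BlockNorm.ofBlocks g blk) G (fun y y' => β * Real.exp (-(δ * g.dist y y'))))
    (hD : ∀ μ, HasMaj (BlockNorm.ofBlocks g blk) (BlockNorm.ofBlocks g blk) (D μ) (fun y y' => β * Real.exp (-(δ * g.dist y y'))))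
    (hV : HasMaj (BlockNorm.ofBlocks g (blkPair blk)) (BlockNorm.ofBlocks g blk) V (diagK fun _ => R)) (hq : β * R * cr < 1) :
    HasMaj (BlockNorm.ofBlocks g blk) (BlockNorm.ofBlocks g blk) (dressedOp G D V)
      (fun y y' => β * (1 - β * R * cr)⁻¹ * Real.exp (-(ρ * g.dist y y'))) := by
  have hSG := hasMaj_stack blk (fun _ _ => mul_nonneg hβ (Real.exp_nonneg _)) hG hD
  exact hasMaj_projO_comp blk (hasMaj_bgPropV blk (blkPair blk) htri hd hrow hσ hρ hρδ hβ hR hSG hV hq) none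

omit [Fintype X'] [DecidableEq X'] in
/-- **(3.65) ON THE PAIR SPACE, READ ON THE `none` COMPONENT**: `G′(U′U) − G′ = G′∘(V̂∘X̂)` («G′(U′U) = G′(U) + G′(U)V′(A)G′(U′U)»). [cite: Balaban1985BackgroundPropagators, (3.65) p.403 (shape)] -/
theorem dressedOp_sub_eq (hunit : IsUnit (1 - LinearMap.toMatrix' (stack G D ∘ₗ V))) :
    dressedOp G D V - G = G ∘ₗ (V ∘ₗ bgPropV (stack G D) V) := by
  have hfix := bgPropV_fix hunit
  have h1 : dressedOp G D V = G + G ∘ₗ (V ∘ₗ bgPropV (stack G D) V) := by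
    unfold dressedOp
    conv_lhs => rw [hfix]
    rw [LinearMap.comp_add]
    rfl
  rw [h1, add_sub_cancel_left]

omit [Fintype X'] [DecidableEq X'] in
/-- **LETTER 2 — THE SMALLNESS** `G′(U′U) − G′ ≤ β·(R·β(1 − βRc_r)⁻¹)·c_r·e^{−ρd}` (`ρ + σ ≤ δ`): the difference carries `V̂` (binder (c) `V̂X̂ ≤ Rβ(1−q)⁻¹e^{−ρd}` of B1a). [cite: Balaban1985BackgroundPropagators, (3.63) p.402 + (3.65) p.403 (shape: the remainders «satisfy Theorem 3.1 with the additional small factor O(1)α₁»)] -/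
theorem hasMaj_dressedOp_sub (htri : Triangle254 g) (hd : ∀ a b : g.Site, 0 ≤ g.dist a b) (hrow : RowSum g σ cr) (hσ : 0 ≤ σ) {ρ : ℝ}
    (hρ : 0 ≤ ρ) (hρδ : ρ + σ ≤ δ) (hβ : 0 ≤ β) (hR : 0 ≤ R)
    (hG : HasMaj (BlockNorm.ofBlocks g blk) (BlockNorm.ofBlocks g blk) G (fun y y' => β * Real.exp (-(δ * g.dist y y'))))
    (hD : ∀ μ, HasMaj (BlockNorm.ofBlocks g blk) (BlockNorm.ofBlocks g blk) (D μ) (fun y y' => β * Real.exp (-(δ * g.dist y y'))))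
    (hV : HasMaj (BlockNorm.ofBlocks g (blkPair blk)) (BlockNorm.ofBlocks g blk) V (diagK fun _ => R)) (hq : β * R * cr < 1) :
    HasMaj (BlockNorm.ofBlocks g blk) (BlockNorm.ofBlocks g blk) (dressedOp G D V - G)
      (fun y y' => β * (R * (β * (1 - β * R * cr)⁻¹)) * cr * Real.exp (-(ρ * g.dist y y'))) := by
  have hβe : ∀ y y' : g.Site, 0 ≤ β * Real.exp (-(δ * g.dist y y')) := fun _ _ => mul_nonneg hβ (Real.exp_nonneg _)
  have hSG := hasMaj_stack blk hβe hG hD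
  have hσδ : σ ≤ δ := by linarith
  have hunit := isUnit_stepV blk (blkPair blk) hd hrow hσδ hβ hR hSG hV hq
  have hVX := hasMaj_V_bgPropV blk (blkPair blk) htri hd hrow hσ hρ hρδ hβ hR hSG hV hq
  have hq' : 0 < 1 - β * R * cr := by linarith
  have hA : 0 ≤ R * (β * (1 - β * R * cr)⁻¹) := mul_nonneg hR (mul_nonneg hβ (inv_nonneg.2 hq'.le))
  have key := hasMaj_comp_exp (b₁ := BlockNorm.ofBlocks g blk) (b₂ := BlockNorm.ofBlocks g blk) (b₃ := BlockNorm.ofBlocks g blk)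
    htri hd hrow hβ hA hρ le_rfl hρδ hG hVX
  rw [dressedOp_sub_eq hunit]
  refine key.mono fun y y' => le_of_eq ?_
  rw [kappa_ofBlocks]
  ring

/-- **LETTER 3 — THE η-DEFECT UNDER THE GUARD** (V0's entry 0 without the source ∕ derived pieces): `U ≡ 1` layer `G, D_μ` (coarse), `G′, D′_μ` (fine) `≤ β·e^{−δd}`,
defects `𝔇(G′,G), 𝔇(D′_μ,D_μ) ≤ m₀θ·e^{−δd}`, `σ ≤ δ`; three letters `V̂, V̂′ ≤ diagK R`, `𝔇(V̂′,V̂) ≤ diagK (Rθ)`; guard `0 ≤ R ≤ K·a₀`, `β(Ka₀)c_r ≤ ½`: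
`𝔇(G′(U′U)′, G′(U′U)) ≤ bgConst(β, c_r, m₀, K, a₀)·θ·e^{−(δ−σ)d}`. [cite: Balaban1985BackgroundPropagators, (3.63)–(3.65) pp.402–403 (mechanism)] -/
theorem hasMaj_idef_dressedOp (htri : Triangle254 g) (hd : ∀ a b : g.Site, 0 ≤ g.dist a b) (hrow : RowSum g σ cr) (hσ : 0 ≤ σ) (hcr : 0 ≤ cr)
    {m₀ θ K a₀ : ℝ} (hσδ : σ ≤ δ) (hβ : 0 ≤ β) (hm₀ : 0 ≤ m₀) (hθ : 0 ≤ θ) (hq : β * (K * a₀) * cr ≤ 1 / 2)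
    (hR0 : 0 ≤ R) (hRa : R ≤ K * a₀)
    (hG : HasMaj (BlockNorm.ofBlocks g blk) (BlockNorm.ofBlocks g blk) G (fun y y' => β * Real.exp (-(δ * g.dist y y'))))
    (hD : ∀ μ, HasMaj (BlockNorm.ofBlocks g blk) (BlockNorm.ofBlocks g blk) (D μ) (fun y y' => β * Real.exp (-(δ * g.dist y y'))))
    (hG' : HasMaj (BlockNorm.ofBlocks g (blk ∘ π)) (BlockNorm.ofBlocks g (blk ∘ π)) G' (fun y y' => β * Real.exp (-(δ * g.dist y y'))))
    (hD' : ∀ μ, HasMaj (BlockNorm.ofBlocks g (blk ∘ π)) (BlockNorm.ofBlocks g (blk ∘ π)) (D' μ) (fun y y' => β * Real.exp (-(δ * g.dist y y'))))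
    (hDG : HasMaj (BlockNorm.ofBlocks g blk) (BlockNorm.ofBlocks g (blk ∘ π)) (idef (pull π) (pull π) G' G)
      (fun y y' => m₀ * θ * Real.exp (-(δ * g.dist y y'))))
    (hDD : ∀ μ, HasMaj (BlockNorm.ofBlocks g blk) (BlockNorm.ofBlocks g (blk ∘ π)) (idef (pull π) (pull π) (D' μ) (D μ))
      (fun y y' => m₀ * θ * Real.exp (-(δ * g.dist y y'))))
    (hV : HasMaj (BlockNorm.ofBlocks g (blkPair blk)) (BlockNorm.ofBlocks g blk) V (diagK fun _ => R))
    (hV' : HasMaj (BlockNorm.ofBlocks g (blkPair (blk ∘ π))) (BlockNorm.ofBlocks g (blk ∘ π)) V' (diagK fun _ => R))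
    (hDV : HasMaj (BlockNorm.ofBlocks g (blkPair blk)) (BlockNorm.ofBlocks g (blk ∘ π)) (idef (pull (liftPair π)) (pull π) V' V)
      (diagK fun _ => R * θ)) :
    HasMaj (BlockNorm.ofBlocks g blk) (BlockNorm.ofBlocks g (blk ∘ π)) (idef (pull π) (pull π) (dressedOp G' D' V') (dressedOp G D V))
      (fun y y' => bgConst β cr m₀ K a₀ * θ * Real.exp (-((δ - σ) * g.dist y y'))) := by
  have hq' : β * R * cr ≤ 1 / 2 := (mul_le_mul_of_nonneg_right (mul_le_mul_of_nonneg_left hRa hβ) hcr).trans hq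
  have hq1 : β * R * cr < 1 := by linarith
  have hinv : (1 - β * R * cr)⁻¹ ≤ 2 := inv_one_sub_le_two hq'
  have hinv0 : 0 ≤ (1 - β * R * cr)⁻¹ := inv_nonneg.2 (by linarith)
  have hβe : ∀ y y' : g.Site, 0 ≤ β * Real.exp (-(δ * g.dist y y')) := fun _ _ => mul_nonneg hβ (Real.exp_nonneg _)
  have hme : ∀ y y' : g.Site, 0 ≤ m₀ * θ * Real.exp (-(δ * g.dist y y')) := fun _ _ => mul_nonneg (mul_nonneg hm₀ hθ) (Real.exp_nonneg _)
  have hSG := hasMaj_stack blk hβe hG hD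
  have hSG' := hasMaj_stack (blk ∘ π) hβe hG' hD'
  have hSDG : HasMaj (BlockNorm.ofBlocks g blk) (BlockNorm.ofBlocks g (blkPair (blk ∘ π)))
      (idef (pull π) (pull (liftPair π)) (stack G' D') (stack G D)) (fun y y' => m₀ * θ * Real.exp (-(δ * g.dist y y'))) := by
    rw [idef_stack]; exact hasMaj_stack (blk ∘ π) hme hDG hDD
  have key := hasMaj_idef_bgPropV blk (blkPair blk) π (liftPair π) htri hd hσ hcr hrow (ρ := δ - σ) (by linarith) (by linarith) hβ hR0 (mul_nonneg hR0 hθ)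
    (mul_nonneg hm₀ hθ) hSG hSG' hSDG hV hV' hDV hq1
  have keyj := hasMaj_projO_comp (blk ∘ π) key none
  have h0 := poly0_le (β := β) (cr := cr) (m₀ := m₀) (θ := θ) (c35 := K) (a₀ := a₀) (r := R) (u := (1 - β * R * cr)⁻¹) hβ hcr hm₀ hθ hR0 hRa hinv0 hinv
  unfold dressedOp
  rw [idef_projO_comp]
  refine keyj.mono fun a b => ?_
  simp only [one_mul]
  exact mul_le_mul_of_nonneg_right h0 (Real.exp_nonneg _)

end Dressed

/-! ## §2 The dressed site kernel from the letters -/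

section Site

/-- THE DRESSED AMPLITUDE `B = β(1 − βRc_r)⁻¹`. [folklore] -/
def xAmp (β R cr : ℝ) : ℝ := β * (1 - β * R * cr)⁻¹

/-- THE (3.66) AMPLITUDE of `C = K − K₀` (S2 `hasMaj_siteC` at `B = xAmp`, `ε = β(R·B)c_r`). [folklore] -/
def cAmp (β R cr r : ℝ) : ℝ :=
  (r * (xAmp β R cr * xAmp β R cr * (1 + r)) + xAmp β R cr * xAmp β R cr * r + (xAmp β R cr + β) * (β * (R * xAmp β R cr) * cr)) * cr

/-- THE AMPLITUDE OF THE SITE-KERNEL η-DEFECT per unit rate `θ` (S1 `hasMaj_idef_siteInv` at `A = β_W(1 − β_W·cAmp·c_r²)⁻¹`, `M = 2(1+r)Bc_r(B·o₀ + bgConst·(1+r))·θ`). [folklore] -/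
def siteAmp (β R cr r m₀ K a₀ o₀ βW : ℝ) : ℝ :=
  βW * (1 - βW * cAmp β R cr r * cr * cr)⁻¹ * (2 * (1 + r) * xAmp β R cr * cr * (xAmp β R cr * o₀ + bgConst β cr m₀ K a₀ * (1 + r))) *
    (βW * (1 - βW * cAmp β R cr r * cr * cr)⁻¹) * cr * cr

/-- The dressed amplitude is non-negative below the operator-layer threshold. [folklore] -/
theorem xAmp_nonneg {β R cr : ℝ} (hβ : 0 ≤ β) (hq : β * R * cr < 1) : 0 ≤ xAmp β R cr := by
  unfold xAmp; exact mul_nonneg hβ (inv_nonneg.2 (by linarith))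

/-- The (3.66) amplitude is non-negative for non-negative letters. [folklore] -/
theorem cAmp_nonneg {β R cr r : ℝ} (hβ : 0 ≤ β) (hR : 0 ≤ R) (hcr : 0 ≤ cr) (hr : 0 ≤ r) (hq : β * R * cr < 1) : 0 ≤ cAmp β R cr r := by
  have hx := xAmp_nonneg hβ hq
  unfold cAmp; positivity

variable {X X' Y J : Type} [Fintype X] [Fintype X'] [Fintype Y] [Fintype J] [DecidableEq X] [DecidableEq X'] [DecidableEq Y] [DecidableEq J] {g : B6.Geometry}
  {σ cr : ℝ}
variable {G : (X → ℝ) →ₗ[ℝ] (X → ℝ)} {D : J → (X → ℝ) →ₗ[ℝ] (X → ℝ)} {G' : (X' → ℝ) →ₗ[ℝ] (X' → ℝ)} {D' : J → (X' → ℝ) →ₗ[ℝ] (X' → ℝ)}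
  {V : (X × Option J → ℝ) →ₗ[ℝ] (X → ℝ)} {V' : (X' × Option J → ℝ) →ₗ[ℝ] (X' → ℝ)}
  {F : (X → ℝ) →ₗ[ℝ] (Y → ℝ)} {Fs : (Y → ℝ) →ₗ[ℝ] (X → ℝ)} {F' : (X' → ℝ) →ₗ[ℝ] (Y → ℝ)} {Fs' : (Y → ℝ) →ₗ[ℝ] (X' → ℝ)}
  {W W' : (Y → ℝ) →ₗ[ℝ] (Y → ℝ)}

/-- **THE η-DEFECT OF THE DRESSED SITE KERNELS FROM THE LETTERS.**  Data: a [B6] carrier ((2.54), `d ≥ 0`, (2.61) at `σ ≥ 0`, `c_r ≥ 0`, `5σ ≤ δ`); lattices `X`, `X′`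
(paired by `π` with UNIFORM fibres `#π⁻¹x = N ≥ 1`) over the site lattice `Y` (`q : X → Y`, `blk = blkY ∘ q`); the `U ≡ 1` LAYER `G, D_μ` ∕ `G′, D′_μ` (`≤ β·e^{−δd}`,
defects `≤ m₀θ·e^{−δd}`); ANY perturbation with the THREE LETTERS (`V̂, V̂′ ≤ diagK R`, `𝔇(V̂′,V̂) ≤ diagK (Rθ)`, guard `0 ≤ R ≤ Ka₀`, `β(Ka₀)c_r ≤ ½`); ANY averaging
species with `F₂, F₂*, F₂′, F₂*′ ≤ diagK r`, fits `𝔇(F₂′,F₂), 𝔇(F₂*′,F₂*) ≤ diagK (o₀θ)`; the `U ≡ 1` SITE KERNELS `W, W′ ≤ β_W·e^{−δd}` with `(QG²Q*)W = 1`,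
`(Q′G′²Q′*)W′ = 1`; site smallness `β_W·cAmp·c_r² ≤ ½`.  CONCLUSION: with `K = (Q + F₂)X²(Q* + F₂*)`, `X = dressedOp G D V̂` and the fine twin,
`𝔇([K′]⁻¹, [K]⁻¹) ≤ siteAmp·θ·e^{−(δ−5σ)d}` — ONE rate factor, every constant explicit.  NOT PRINTED (no η-rate is); the mechanism of (3.65)–(3.67) + the
resolvent identity. [cite: Balaban1985BackgroundPropagators, (3.65)–(3.67) p.403 (mechanism); Thm 3.2 (3.48) p.398 (the `U ≡ 1` site kernel's majorant); King1986, p.664 (pairing)] -/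
theorem hasMaj_idef_dressedSite (htri : Triangle254 g) (hd : ∀ a b : g.Site, 0 ≤ g.dist a b) (hrow : RowSum g σ cr) (hσ : 0 ≤ σ) (hcr : 0 ≤ cr)
    (blk : X → g.Site) (blkY : Y → g.Site) (q : X → Y) (π : X' → X) (hq : ∀ x, blk x = blkY (q x)) {N : ℕ} (hN : N ≠ 0)
    (hfib : ∀ x, (fibre π x).card = N)
    {δ β m₀ θ K a₀ R r o₀ βW : ℝ} (hσδ : 5 * σ ≤ δ) (hβ : 0 ≤ β) (hm₀ : 0 ≤ m₀) (hθ : 0 ≤ θ) (hK : 0 ≤ K) (ha₀ : 0 ≤ a₀)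
    (hq1 : β * (K * a₀) * cr ≤ 1 / 2) (hR0 : 0 ≤ R) (hRa : R ≤ K * a₀) (hr : 0 ≤ r) (ho₀ : 0 ≤ o₀) (hβW : 0 ≤ βW)
    (hq2 : βW * cAmp β R cr r * cr * cr ≤ 1 / 2)
    (hG : HasMaj (BlockNorm.ofBlocks g blk) (BlockNorm.ofBlocks g blk) G (fun y y' => β * Real.exp (-(δ * g.dist y y'))))
    (hD : ∀ μ, HasMaj (BlockNorm.ofBlocks g blk) (BlockNorm.ofBlocks g blk) (D μ) (fun y y' => β * Real.exp (-(δ * g.dist y y'))))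
    (hG' : HasMaj (BlockNorm.ofBlocks g (blk ∘ π)) (BlockNorm.ofBlocks g (blk ∘ π)) G' (fun y y' => β * Real.exp (-(δ * g.dist y y'))))
    (hD' : ∀ μ, HasMaj (BlockNorm.ofBlocks g (blk ∘ π)) (BlockNorm.ofBlocks g (blk ∘ π)) (D' μ) (fun y y' => β * Real.exp (-(δ * g.dist y y'))))
    (hDG : HasMaj (BlockNorm.ofBlocks g blk) (BlockNorm.ofBlocks g (blk ∘ π)) (idef (pull π) (pull π) G' G)
      (fun y y' => m₀ * θ * Real.exp (-(δ * g.dist y y'))))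
    (hDD : ∀ μ, HasMaj (BlockNorm.ofBlocks g blk) (BlockNorm.ofBlocks g (blk ∘ π)) (idef (pull π) (pull π) (D' μ) (D μ))
      (fun y y' => m₀ * θ * Real.exp (-(δ * g.dist y y'))))
    (hV : HasMaj (BlockNorm.ofBlocks g (blkPair blk)) (BlockNorm.ofBlocks g blk) V (diagK fun _ => R))
    (hV' : HasMaj (BlockNorm.ofBlocks g (blkPair (blk ∘ π))) (BlockNorm.ofBlocks g (blk ∘ π)) V' (diagK fun _ => R))
    (hDV : HasMaj (BlockNorm.ofBlocks g (blkPair blk)) (BlockNorm.ofBlocks g (blk ∘ π)) (idef (pull (liftPair π)) (pull π) V' V)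
      (diagK fun _ => R * θ))
    (hF : HasMaj (BlockNorm.ofBlocks g blk) (BlockNorm.ofBlocks g blkY) F (diagK fun _ => r))
    (hFs : HasMaj (BlockNorm.ofBlocks g blkY) (BlockNorm.ofBlocks g blk) Fs (diagK fun _ => r))
    (hF' : HasMaj (BlockNorm.ofBlocks g (blk ∘ π)) (BlockNorm.ofBlocks g blkY) F' (diagK fun _ => r))
    (hFs' : HasMaj (BlockNorm.ofBlocks g blkY) (BlockNorm.ofBlocks g (blk ∘ π)) Fs' (diagK fun _ => r))
    (hDF : HasMaj (BlockNorm.ofBlocks g blk) (BlockNorm.ofBlocks g blkY) (idef (pull π) LinearMap.id F' F) (diagK fun _ => o₀ * θ))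
    (hDFs : HasMaj (BlockNorm.ofBlocks g blkY) (BlockNorm.ofBlocks g (blk ∘ π)) (idef LinearMap.id (pull π) Fs' Fs) (diagK fun _ => o₀ * θ))
    (hW : HasMaj (BlockNorm.ofBlocks g blkY) (BlockNorm.ofBlocks g blkY) W (fun y y' => βW * Real.exp (-(δ * g.dist y y'))))
    (hW' : HasMaj (BlockNorm.ofBlocks g blkY) (BlockNorm.ofBlocks g blkY) W' (fun y y' => βW * Real.exp (-(δ * g.dist y y'))))
    (hKW : siteForm₀ q G ∘ₗ W = LinearMap.id) (hKW' : siteForm₀ (q ∘ π) G' ∘ₗ W' = LinearMap.id) :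
    HasMaj (BlockNorm.ofBlocks g blkY) (BlockNorm.ofBlocks g blkY)
      (idef LinearMap.id LinearMap.id (siteInv W' (siteForm₀ (q ∘ π) G') (siteForm (q ∘ π) F' Fs' (dressedOp G' D' V')))
        (siteInv W (siteForm₀ q G) (siteForm q F Fs (dressedOp G D V))))
      (fun y y' => siteAmp β R cr r m₀ K a₀ o₀ βW * θ * Real.exp (-((δ - 5 * σ) * g.dist y y'))) := by
  -- smallness bookkeeping
  have hq' : β * R * cr ≤ 1 / 2 := (mul_le_mul_of_nonneg_right (mul_le_mul_of_nonneg_left hRa hβ) hcr).trans hq1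
  have hqlt : β * R * cr < 1 := by linarith
  have hB : 0 ≤ xAmp β R cr := xAmp_nonneg hβ hqlt
  have hC0 : 0 ≤ cAmp β R cr r := cAmp_nonneg hβ hR0 hcr hr hqlt
  have hq2lt : βW * cAmp β R cr r * cr * cr < 1 := by linarith
  have hq' : ∀ x', (blk ∘ π) x' = blkY ((q ∘ π) x') := fun x' => hq (π x')
  -- §1's three letters at the rate δ − σ, both spacings
  have hX : HasMaj (BlockNorm.ofBlocks g blk) (BlockNorm.ofBlocks g blk) (dressedOp G D V)
      (fun y y' => xAmp β R cr * Real.exp (-((δ - σ) * g.dist y y'))) :=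
    hasMaj_dressedOp blk htri hd hrow hσ (ρ := δ - σ) (by linarith) (by linarith) hβ hR0 hG hD hV hqlt
  have hX' : HasMaj (BlockNorm.ofBlocks g (blk ∘ π)) (BlockNorm.ofBlocks g (blk ∘ π)) (dressedOp G' D' V')
      (fun y y' => xAmp β R cr * Real.exp (-((δ - σ) * g.dist y y'))) :=
    hasMaj_dressedOp (blk ∘ π) htri hd hrow hσ (ρ := δ - σ) (by linarith) (by linarith) hβ hR0 hG' hD' hV' hqlt
  have hE : HasMaj (BlockNorm.ofBlocks g blk) (BlockNorm.ofBlocks g blk) (dressedOp G D V - G)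
      (fun y y' => β * (R * xAmp β R cr) * cr * Real.exp (-((δ - σ) * g.dist y y'))) :=
    hasMaj_dressedOp_sub blk htri hd hrow hσ (ρ := δ - σ) (by linarith) (by linarith) hβ hR0 hG hD hV hqlt
  have hE' : HasMaj (BlockNorm.ofBlocks g (blk ∘ π)) (BlockNorm.ofBlocks g (blk ∘ π)) (dressedOp G' D' V' - G')
      (fun y y' => β * (R * xAmp β R cr) * cr * Real.exp (-((δ - σ) * g.dist y y'))) :=
    hasMaj_dressedOp_sub (blk ∘ π) htri hd hrow hσ (ρ := δ - σ) (by linarith) (by linarith) hβ hR0 hG' hD' hV' hqlt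
  have hDX := hasMaj_idef_dressedOp blk π htri hd hrow hσ hcr (by linarith : σ ≤ δ) hβ hm₀ hθ hq1 hR0 hRa hG hD hG' hD' hDG hDD hV hV' hDV
  -- the `U ≡ 1` pieces at the rate δ − σ
  have hG₁ : HasMaj (BlockNorm.ofBlocks g blk) (BlockNorm.ofBlocks g blk) G (fun y y' => β * Real.exp (-((δ - σ) * g.dist y y'))) :=
    hasMaj_exp_mono hd hβ (by linarith) hG
  have hG₁' : HasMaj (BlockNorm.ofBlocks g (blk ∘ π)) (BlockNorm.ofBlocks g (blk ∘ π)) G' (fun y y' => β * Real.exp (-((δ - σ) * g.dist y y'))) :=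
    hasMaj_exp_mono hd hβ (by linarith) hG'
  -- S2: the perturbation C = K − K₀ at δ − 2σ, both spacings
  have hEamp : 0 ≤ β * (R * xAmp β R cr) * cr := mul_nonneg (mul_nonneg hβ (mul_nonneg hR0 hB)) hcr
  have hC := hasMaj_siteC htri hd hrow hσ hcr blk blkY q hq (ρ := δ - 2 * σ) hB hβ hEamp hr (by linarith) (by linarith) hX hG₁ hE hF hFs
  have hC' := hasMaj_siteC htri hd hrow hσ hcr (blk ∘ π) blkY (q ∘ π) hq' (ρ := δ - 2 * σ) hB hβ hEamp hr (by linarith) (by linarith)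
    hX' hG₁' hE' hF' hFs'
  -- S2: the defect of the dressed site form at δ − 2σ
  have hDK := hasMaj_idef_siteForm htri hd hrow hσ blk blkY q π hq hN hfib (ρ := δ - 2 * σ) hB
    (mul_nonneg (bgConst_nonneg hβ hcr hm₀ hK ha₀) hθ) hr (mul_nonneg ho₀ hθ) (by linarith) (by linarith) hX hX' hDX hFs hF' hFs' hDF hDFs
  -- the `U ≡ 1` site kernels at δ − 2σ
  have hW₂ : HasMaj (BlockNorm.ofBlocks g blkY) (BlockNorm.ofBlocks g blkY) W (fun y y' => βW * Real.exp (-((δ - 2 * σ) * g.dist y y'))) :=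
    hasMaj_exp_mono hd hβW (by linarith) hW
  have hW₂' : HasMaj (BlockNorm.ofBlocks g blkY) (BlockNorm.ofBlocks g blkY) W' (fun y y' => βW * Real.exp (-((δ - 2 * σ) * g.dist y y'))) :=
    hasMaj_exp_mono hd hβW (by linarith) hW'
  -- S1: the exact inverse rule
  have hMK : 0 ≤ 2 * (1 + r) * xAmp β R cr * cr * (xAmp β R cr * (o₀ * θ) + bgConst β cr m₀ K a₀ * θ * (1 + r)) := by
    have := bgConst_nonneg hβ hcr hm₀ hK ha₀; positivity
  have key := hasMaj_idef_siteInv blkY htri hd hrow hσ hcr (ρ := δ - 5 * σ) hβW hC0 hMK (by linarith) (by linarith) hW₂ hW₂'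
    (hC.mono fun y y' => le_of_eq (by unfold cAmp; ring)) (hC'.mono fun y y' => le_of_eq (by unfold cAmp; ring)) hDK hKW hKW' hq2lt
  refine key.mono fun y y' => le_of_eq ?_
  unfold siteAmp
  ring

end Site

end Summit.QuantumFields.YangMills.BalabanUVNodes.N15.SiteLayer

end
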